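import Summits.CriticalPhenomena.PercolationContinuityZ3.Theorems.PercNearOneGluingNoHeavyQuantExplorationEntropic
import HarnessLib

/-!
# PAPER-2 track, ARM-3 (route C2), part 2/2: the ENTROPIC BOUND for the ONE-ARM event — `P_q(0 ↔ ∂Λ_R) ≤ 2 P_p(0 ↔ ∂Λ_R)
# + 16 d · kl(p‖q) · Σ_{x ∈ Λ_R} P_p(0 ↔ x in Λ_R)` on `ℤ^d`, from the tree's cluster exploration

builds on p205010 (kernel theorem, internal audit signed; external expert review pending).
Status sentence for p205010: "θ(p_c) = 0 on ℤ^d, all d ≥ 2 — kernel-verified (Lean 4/Mathlib, standard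
axioms); internal adversarial audit SIGNED 2026-08-20 04:29Z; external expert review pending."

Seat `prim-quant-arm-3`, `--supports stmt-CriticalPhenomena-4575`; pure proofs, no definitions.  Companion of
`…QuantOneArmOfChiSubcritical.lean` (route C1, `ξ`-free) and of the memo `run/shared/lean/prim/quant/prim-quant-arm-3/POWERLAW-SURVEY.md`
§4(C).  The relative-entropy ("entropic", OSSS-type) inequality of Dewan–Muirhead / Hutchcroft,
`|P_p[A] − P_{p'}[A]| ≲ |p − p'| √(P[A] · E_{p'}|C_Λ(0)|)` for an event `A` measurable with respect to the cluster of `0`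
inside `Λ`, is in the tree for the VOLUME events `{|C(0)| ≥ n}` (`ClusterExploration.real_clusterSizeGe_le_of_kl`,
Hutchcroft 2022 Thm. 1.3).  This file proves it for the ARM event `{0 ↔ ∂Λ_R in Λ_R}` (`siteToBoundary d R`):

* (part 1, `…QuantExplorationEntropic.lean`: the event-agnostic core `Quant.real_setOf_run_le_of_kl` and the restricted-lattice
  bookkeeping);
* `Quant.real_siteToBoundary_le_of_kl` — **`P_q(0 ↔ ∂Λ_R) ≤ 2 P_p(0 ↔ ∂Λ_R) + 16 d · kl(p‖q) · Σ_{x∈Λ_R} P_p(0 ↔ x in Λ_R)`**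
  for all `p, q ∈ (0,1)`, `d ≥ 1`, `R ≥ 0`: the exploration of the cluster of `0` in the lattice RESTRICTED to `Λ_R`
  (`restrictTo (zdGraph d) Λ_R`, degrees `≤ 2d`, step budget `2d(|Λ_R|+1)+1` so that it always exhausts the cluster)
  computes the arm event; the restricted percolation measure is the image of `P_p` under `ω ↦ ω ∩ E(Λ_R)`
  (`setBernoulli_map_inter`) and the run only reads edges of `Λ_R` (`run_congr`).

* `Quant.oneArm_criticalProb_le_entropic(_chi)` — at `p_c` against a subcritical `q`:
  **`π_{p_c}(R) ≤ 2 π_q(R) + (8d/(q(1−p_c)²)) (p_c − q)² χ_R(q)`**, `χ_R(q) = Σ_{x∈Λ_R} P_q(0 ↔ x in Λ_R) ≤ χ(q)`.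

Use (survey §4 C2): with `q = p_c − s` this reads `π_{p_c}(R) ≤ 2 π_{p_c−s}(R) + K_d s² χ_R(p_c − s)`,
so a correlation-length input (`π_{p_c−s}(R) ≤ π_{p_c}(R)/4` at `s ≍ R^{−1/ν'}`) and a susceptibility input
(`χ ≤ M s^{−g}`) give `π_{p_c}(R) ≲ R^{−(2−g)/ν'}` (Dewan–Muirhead 2023 Thm. 1.10's `η₁ ≥ (2−γ)/ν`; in high dimensions
Kozma–Nachmias's `2`, van Engelenburg–Garban–Panis–Severo 2025).  Nothing here is a rate for `d = 3`: both inputs are open there.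
[cite: Hutchcroft2022Triangle, Thm. 1.3 and §4 (Thm. 4.1)] [cite: DewanMuirhead2022, §2 (Prop. 2.1) and Thm. 1.10]
-/


noncomputable section

namespace Summit.CriticalPhenomena.PercolationContinuityZ3.Theorems.Quant

open MeasureTheory Literature.Probability.Percolation Literature.Probability.LatticeModels
open Literature.Probability.Percolation.ClusterExploration Literature.Probability.Entropy
open scoped ENNReal

/-! ### §3. The entropic bound for the one-arm event on `ℤ^d` -/

section Arm

variable {d : ℕ}

/-- **THE ENTROPIC BOUND FOR THE ONE-ARM EVENT.**  For `d ≥ 1`, `R ≥ 0` and `p, q ∈ (0,1)`: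
`P_q(0 ↔ ∂Λ_R in Λ_R) ≤ 2 P_p(0 ↔ ∂Λ_R in Λ_R) + 16 d · kl(p‖q) · Σ_{x ∈ Λ_R} P_p(0 ↔ x in Λ_R)`
(`siteToBoundary d R`, `openConnIn Λ_R 0 x`, `kl = binaryKL`).  Proof: explore the cluster of `0` in the lattice restricted to
`Λ_R` (`restrictTo (zdGraph d) Λ_R`, degrees `≤ 2d`, cap `|Λ_R|+1` never reached, budget `2d(|Λ_R|+1)+1` so the run halts with the
whole cluster found); apply `real_setOf_run_le_of_kl` to the predicate "the active set meets `∂ⁱⁿΛ_R`"; transport the three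
terms to `P` on `ℤ^d` through `ω ↦ ω ∩ E(Λ_R)` (`bondPercolation_restrictTo_eq_map`, `run_inter_edgeSet`) and identify them
up to the null set of configurations using non-edges (`real_congr_of_forall_subset_edgeSet`).  This is the arm-event instance of
Dewan–Muirhead's relative-entropy bound / Hutchcroft's Thm. 4.1; new in the tree (the volume-event instance is
`ClusterExploration.real_clusterSizeGe_le_of_kl`).
[cite: DewanMuirhead2022, §2 (Prop. 2.1, the entropic bound for A₁(R))] [cite: Hutchcroft2022Triangle, Thm. 4.1] -/
theorem real_siteToBoundary_le_of_kl (hd : 1 ≤ d) (R : ℕ) (p q : unitInterval)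
    (hp0 : 0 < (p : ℝ)) (hp1 : (p : ℝ) < 1) (hq0 : 0 < (q : ℝ)) (hq1 : (q : ℝ) < 1) :
    (bondPercolation (zdGraph d) q).real (siteToBoundary d R) ≤
      2 * (bondPercolation (zdGraph d) p).real (siteToBoundary d R) +
        16 * d * binaryKL p q *
          ∑ x ∈ box d R, (bondPercolation (zdGraph d) p).real (openConnIn (↑(box d R) : Set (Site d)) 0 x) := by
  classical
  set S : Set (Site d) := (↑(box d R) : Set (Site d)) with hSdef
  set G' : SimpleGraph (Site d) := restrictTo (zdGraph d) S with hG'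
  set E' : Set (Sym2 (Site d)) := G'.edgeSet with hE'
  have h0S : (0 : Site d) ∈ S := by rw [hSdef]; exact Finset.mem_coe.2 (zero_mem_box d R)
  -- local finiteness and degrees of the restricted lattice
  letI hLF : G'.LocallyFinite := fun v =>
    @Set.fintypeSubset _ ((zdGraph d).neighborSet v) _ _ (Classical.decPred _)
      (fun w hw => (SimpleGraph.mem_neighborSet _ _ _).2 ((SimpleGraph.mem_neighborSet _ _ _).1 hw).1)
  have hΔ : ∀ v, G'.degree v ≤ 2 * d := by
    intro v
    rw [← SimpleGraph.card_neighborSet_eq_degree]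
    calc Fintype.card (G'.neighborSet v) ≤ Fintype.card ((zdGraph d).neighborSet v) :=
          Set.card_le_card fun w hw =>
            (SimpleGraph.mem_neighborSet _ _ _).2 ((SimpleGraph.mem_neighborSet _ _ _).1 hw).1
      _ = (zdGraph d).degree v := SimpleGraph.card_neighborSet_eq_degree _ _
      _ ≤ 2 * d := degree_zdGraph_le v
  -- the cap and the budget
  set n : ℕ := (box d R).card + 1 with hn
  have hn1 : 1 ≤ n := by omega
  set N : ℕ := 2 * d * n + 1 with hN
  -- the arm predicate on states, and the point predicates
  let Φ : State (Site d) → Prop := fun σ => ∃ y ∈ innerBoundary (zdGraph d) (box d R), y ∈ σ.A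
  -- (1) the generic bound on the restricted lattice
  have hgen := real_setOf_run_le_of_kl (G := G') (n := n) hΔ (0 : Site d) p q hp0 hp1 hq0 hq1 N Φ
  -- (2) transport of state events: `P^{G'}_r {Φ(run)} = P_r {Φ(run)}` for any state predicate
  have htrans : ∀ (r : unitInterval) (Ψ : State (Site d) → Prop),
      (bondPercolation G' r).real {ω | Ψ (run G' n 0 ω N)} =
        (bondPercolation (zdGraph d) r).real {ω | Ψ (run G' n 0 ω N)} := by
    intro r Ψ
    rw [bondPercolation_restrictTo_eq_map, map_measureReal_apply (measurable_inter_const E')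
      (measurableSet_setOf_run 0 N Ψ)]
    congr 1
    ext ω
    simp only [Set.mem_preimage, Set.mem_setOf_eq]
    rw [run_inter_edgeSet]
  -- (3) correctness: for `ω ⊆ E(ℤ^d)` the active set at time `N` is the open cluster of `0` in `Λ_R`
  have hclus : ∀ ω : Set (Sym2 (Site d)), ω ⊆ (zdGraph d).edgeSet →
      (↑(run G' n 0 ω N).A : Set (Site d)) = openCluster (ω ∩ E') 0 ∧
        openGraph (ω ∩ E') = restrictTo (openGraph ω) S := by
    intro ω hω
    have hω' : ω ∩ E' ⊆ G'.edgeSet := Set.inter_subset_right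
    have hsmall : (openCluster (ω ∩ E') (0 : Site d)).encard < n := by
      have hsub := openCluster_subset_of_subset_edgeSet_restrictTo (G := zdGraph d) hω' h0S
      calc (openCluster (ω ∩ E') (0 : Site d)).encard ≤ S.encard := Set.encard_mono hsub
        _ = ((box d R).card : ℕ∞) := by rw [hSdef, Set.encard_coe_eq_coe_finsetCard]
        _ < n := by rw [hn]; exact_mod_cast Nat.lt_succ_self _
    have hH : Halted G' n (run G' n 0 (ω ∩ E') N) := by
      rw [hN]; exact halted_run 0 (ω ∩ E') hΔ hn1
    refine ⟨?_, openGraph_inter_edgeSet_restrictTo hω S⟩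
    rw [← run_inter_edgeSet (G := G') (n := n) 0 ω N]
    exact coe_A_run_eq_openCluster 0 hω' hH hsmall
  -- (4) the arm terms: `P^{G'}_r {Φ(run)} = P_r (0 ↔ ∂Λ_R)`
  have harm : ∀ r : unitInterval, (bondPercolation G' r).real {ω | Φ (run G' n 0 ω N)} =
      (bondPercolation (zdGraph d) r).real (siteToBoundary d R) := by
    intro r
    rw [htrans r Φ]
    refine DCT16.real_congr_of_forall_subset_edgeSet (zdGraph d) r fun ω hω => ?_
    obtain ⟨hA, hgr⟩ := hclus ω hω
    simp only [Set.mem_setOf_eq, Φ, siteToBoundary]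
    constructor
    · rintro ⟨y, hy, hyA⟩
      refine ⟨y, hy, ?_⟩
      have hyC : y ∈ openCluster (ω ∩ E') 0 := hA ▸ Finset.mem_coe.2 hyA
      rw [mem_openConnIn_iff_reachable_restrictTo, ← hgr]
      exact ⟨h0S, hyC⟩
    · rintro ⟨y, hy, hyconn⟩
      refine ⟨y, hy, ?_⟩
      rw [mem_openConnIn_iff_reachable_restrictTo, ← hgr] at hyconn
      have hyC : y ∈ openCluster (ω ∩ E') 0 := hyconn.2
      rw [← hA] at hyC
      exact Finset.mem_coe.1 hyC
  -- (5) the expected active-set size: `∫ |A_N| dP^{G'}_p ≤ Σ_{x ∈ Λ_R} P_p(0 ↔ x in Λ_R)`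
  have hAsub : ∀ ω, (↑(run G' n 0 ω N).A : Set (Site d)) ⊆ S :=
    fun ω => run_A_subset (G := G') (n := n) 0 ω S h0S (fun u v huv => huv.2.2) N
  have hint : ∫ ω, ((run G' n 0 ω N).A.card : ℝ) ∂(bondPercolation G' p) =
      ∑ x ∈ box d R, (bondPercolation G' p).real {ω | x ∈ (run G' n 0 ω N).A} := by
    have hpt : ∀ ω, ((run G' n 0 ω N).A.card : ℝ) =
        ∑ x ∈ box d R, ({ω | x ∈ (run G' n 0 ω N).A} : Set _).indicator (fun _ => (1 : ℝ)) ω := by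
      intro ω
      have hsubF : (run G' n 0 ω N).A ⊆ box d R := fun x hx =>
        Finset.mem_coe.1 (by have := hAsub ω (Finset.mem_coe.2 hx); rwa [hSdef] at this)
      rw [← Finset.sum_subset hsubF (fun x _ hx => by
        rw [Set.indicator_of_notMem (show ω ∉ {ω | x ∈ (run G' n 0 ω N).A} from hx)])]
      rw [Finset.sum_congr rfl (fun x (hx : x ∈ (run G' n 0 ω N).A) =>
        Set.indicator_of_mem (show ω ∈ {ω | x ∈ (run G' n 0 ω N).A} from hx) (fun _ => (1 : ℝ)))]
      simp
    simp_rw [hpt]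
    rw [integral_finsetSum _ fun x _ =>
      (integrable_const (1 : ℝ)).indicator (measurableSet_setOf_run 0 N fun σ => x ∈ σ.A)]
    refine Finset.sum_congr rfl fun x _ => ?_
    rw [integral_indicator_const _ (measurableSet_setOf_run 0 N fun σ => x ∈ σ.A), smul_eq_mul, mul_one]
  have hpoint : ∀ x ∈ box d R, (bondPercolation G' p).real {ω | x ∈ (run G' n 0 ω N).A} ≤
      (bondPercolation (zdGraph d) p).real (openConnIn S 0 x) := by
    intro x _
    rw [htrans p (fun σ => x ∈ σ.A)]
    refine DCT16.real_mono_of_forall_subset_edgeSet (zdGraph d) p fun ω hω hx => ?_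
    obtain ⟨hA, hgr⟩ := hclus ω hω
    have hxC : x ∈ openCluster (ω ∩ E') 0 := hA ▸ Finset.mem_coe.2 hx
    rw [mem_openConnIn_iff_reachable_restrictTo, ← hgr]
    exact ⟨h0S, hxC⟩
  have hS : ∫ ω, ((run G' n 0 ω N).A.card : ℝ) ∂(bondPercolation G' p) ≤
      ∑ x ∈ box d R, (bondPercolation (zdGraph d) p).real (openConnIn S 0 x) := by
    rw [hint]; exact Finset.sum_le_sum hpoint
  -- (6) assemble
  have hkl0 : 0 ≤ 8 * ((2 * d : ℕ) : ℝ) * binaryKL p q := by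
    have h := hgen
    -- `kl ≥ 0` is implicit in the generic bound; derive it directly as in §1
    have h1 : 1 - (q : ℝ) / p ≤ Real.log (p / q) := by
      have := Real.log_le_sub_one_of_pos (show 0 < (q : ℝ) / p by positivity)
      rw [Real.log_div hq0.ne' hp0.ne'] at this
      rw [Real.log_div hp0.ne' hq0.ne']
      linarith
    have h2 : 1 - (1 - (q : ℝ)) / (1 - p) ≤ Real.log ((1 - p) / (1 - q)) := by
      have h1p : (0 : ℝ) < 1 - p := by linarith
      have h1q : (0 : ℝ) < 1 - q := by linarith
      have := Real.log_le_sub_one_of_pos (show 0 < (1 - (q : ℝ)) / (1 - p) by positivity)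
      rw [Real.log_div h1q.ne' h1p.ne'] at this
      rw [Real.log_div h1p.ne' h1q.ne']
      linarith
    have h1p : (0 : ℝ) < 1 - p := by linarith
    have hkl : 0 ≤ binaryKL p q :=
      calc (0 : ℝ) = p * (1 - q / p) + (1 - p) * (1 - (1 - q) / (1 - p)) := by field_simp; ring
        _ ≤ p * Real.log (p / q) + (1 - p) * Real.log ((1 - p) / (1 - q)) :=
            add_le_add (mul_le_mul_of_nonneg_left h1 hp0.le) (mul_le_mul_of_nonneg_left h2 h1p.le)
        _ = binaryKL p q := rfl
    positivity
  rw [harm q, harm p] at hgen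
  calc (bondPercolation (zdGraph d) q).real (siteToBoundary d R)
      ≤ 2 * (bondPercolation (zdGraph d) p).real (siteToBoundary d R) +
          8 * ((2 * d : ℕ) : ℝ) * binaryKL p q * ∫ ω, ((run G' n 0 ω N).A.card : ℝ) ∂(bondPercolation G' p) := hgen
    _ ≤ 2 * (bondPercolation (zdGraph d) p).real (siteToBoundary d R) +
          8 * ((2 * d : ℕ) : ℝ) * binaryKL p q *
            ∑ x ∈ box d R, (bondPercolation (zdGraph d) p).real (openConnIn S 0 x) := by
        gcongr
    _ = _ := by push_cast; ring

/-! ### §4. At `p_c`: `π_{p_c}(R) ≤ 2 π_q(R) + (8d/(q(1−p_c)²)) (p_c − q)² χ_R(q)` for subcritical `q` -/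

/-- The binary relative entropy against a larger parameter: for `0 < q ≤ p < 1`,
`kl(q‖p) ≤ (p − q)² / (2 q (1 − p)²)` (write `q = 1 − e^{−a}`, `p = 1 − e^{−b}` and use
`binaryKL_one_sub_exp_le`: `kl ≤ (b−a)²/(2a)` with `a ≥ q`, `0 ≤ b − a ≤ (p−q)/(1−p)`). [folklore] -/
theorem binaryKL_le_sq_div {q p : ℝ} (hq0 : 0 < q) (hqp : q ≤ p) (hp1 : p < 1) :
    binaryKL q p ≤ (p - q) ^ 2 / (2 * q * (1 - p) ^ 2) := by
  have hq1 : q < 1 := lt_of_le_of_lt hqp hp1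
  have h1q : 0 < 1 - q := by linarith
  have h1p : 0 < 1 - p := by linarith
  set a : ℝ := -Real.log (1 - q) with ha
  set b : ℝ := -Real.log (1 - p) with hb
  have haq : q ≤ a := by
    have := Real.log_le_sub_one_of_pos h1q
    rw [ha]; linarith
  have ha0 : 0 < a := lt_of_lt_of_le hq0 haq
  have hbp : p ≤ b := by
    have := Real.log_le_sub_one_of_pos h1p
    rw [hb]; linarith
  have hb0 : 0 < b := lt_of_lt_of_le (lt_of_lt_of_le hq0 hqp) hbp
  have hqa : 1 - Real.exp (-a) = q := by rw [ha, neg_neg, Real.exp_log h1q]; ring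
  have hpb : 1 - Real.exp (-b) = p := by rw [hb, neg_neg, Real.exp_log h1p]; ring
  have hab : a ≤ b := by
    rw [ha, hb]
    exact neg_le_neg (Real.log_le_log h1p (by linarith))
  -- `b - a = log((1-q)/(1-p)) ≤ (1-q)/(1-p) - 1 = (p-q)/(1-p)`
  have hba : b - a ≤ (p - q) / (1 - p) := by
    have hratio : 0 < (1 - q) / (1 - p) := div_pos h1q h1p
    have hlog := Real.log_le_sub_one_of_pos hratio
    rw [Real.log_div h1q.ne' h1p.ne'] at hlog
    have : (1 - q) / (1 - p) - 1 = (p - q) / (1 - p) := by field_simp; ring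
    rw [ha, hb]; linarith
  have hba0 : 0 ≤ b - a := by linarith
  have hkl := binaryKL_one_sub_exp_le ha0 hb0
  rw [hqa, hpb, min_eq_left hab] at hkl
  calc binaryKL q p ≤ (a - b) ^ 2 / (2 * a) := hkl
    _ = (b - a) ^ 2 / (2 * a) := by rw [show (a - b) ^ 2 = (b - a) ^ 2 by ring]
    _ ≤ ((p - q) / (1 - p)) ^ 2 / (2 * q) := by
        gcongr
    _ = (p - q) ^ 2 / (2 * q * (1 - p) ^ 2) := by
        field_simp

/-- `{0 ↔ x in Λ_R} ⊆ {0 ↔ x}`, hence `Σ_{x ∈ Λ_R} P_q(0 ↔ x in Λ_R) ≤ χ(q)` below `p_c` (`d ≥ 2`). [folklore] -/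
theorem sum_real_openConnIn_box_le_chi (hd : 2 ≤ d) (R : ℕ) (q : unitInterval)
    (hq : (q : ℝ) < criticalProb (zdGraph d) (0 : Site d)) :
    ∑ x ∈ box d R, (bondPercolation (zdGraph d) q).real (openConnIn (↑(box d R) : Set (Site d)) 0 x) ≤
      chi d q := by
  have hs := summable_tau_of_lt_criticalProb hd q hq
  calc ∑ x ∈ box d R, (bondPercolation (zdGraph d) q).real (openConnIn (↑(box d R) : Set (Site d)) 0 x)
      ≤ ∑ x ∈ box d R, tau d q 0 x := by
        refine Finset.sum_le_sum fun x _ => ?_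
        rw [tau_def]
        refine measureReal_mono fun ω hω => ?_
        obtain ⟨-, h⟩ := mem_openConnIn_iff_reachable_restrictTo.1 hω
        exact h.mono (restrictTo_le _ _)
    _ ≤ chi d q := hs.sum_le_tsum _ fun y _ => tau_nonneg _ 0 y

/-- **The one-arm entropic inequality at `p_c` (route C2's dictionary core).**  For `d ≥ 2`, `R ≥ 0` and a SUBCRITICAL
`0 < q < p_c`: `π_{p_c}(R) ≤ 2 π_q(R) + (8d / (q (1 − p_c)²)) (p_c − q)² Σ_{x ∈ Λ_R} P_q(0 ↔ x in Λ_R)`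
(`≤ … (p_c − q)² χ(q)` by `sum_real_openConnIn_box_le_chi`).  Hence a correlation-length input making
`π_q(R) ≤ π_{p_c}(R)/4` at `p_c − q ≍ R^{−1/ν'}` and a susceptibility input `χ(q) ≤ M (p_c − q)^{−g}` give
`π_{p_c}(R) ≲ R^{−(2−g)/ν'}` — Dewan–Muirhead's `η₁ ≥ (2−γ)/ν` as a kernel dictionary shape; in high dimensions this
is the entropic route to Kozma–Nachmias's exponent `2`.  CONDITIONAL use only: for `3 ≤ d ≤ 6` both inputs are open.
[cite: DewanMuirhead2022, Thm. 1.10 and §2 (P_{p_c}[A₁(R)] ≤ c (p_c−p')² Σ_v P_{p'}[0 ↔ v])] [cite: Hutchcroft2022Triangle, Thm. 4.1] -/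
theorem oneArm_criticalProb_le_entropic (hd : 2 ≤ d) (R : ℕ) (q : unitInterval) (hq0 : 0 < (q : ℝ))
    (hqc : (q : ℝ) < criticalProbI d) :
    (bondPercolation (zdGraph d) (criticalProbI d)).real (siteToBoundary d R) ≤
      2 * (bondPercolation (zdGraph d) q).real (siteToBoundary d R) +
        8 * d / ((q : ℝ) * (1 - criticalProbI d) ^ 2) * ((criticalProbI d : ℝ) - q) ^ 2 *
          ∑ x ∈ box d R, (bondPercolation (zdGraph d) q).real (openConnIn (↑(box d R) : Set (Site d)) 0 x) := by
  have hd1 : 1 ≤ d := by omega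
  have hdR : (0 : ℝ) < d := by exact_mod_cast (show 0 < d by omega)
  have hpc0 : 0 < (criticalProbI d : ℝ) := by rw [coe_criticalProbI]; exact criticalProb_zd_pos d hd1
  have hpc1 : (criticalProbI d : ℝ) < 1 := by rw [coe_criticalProbI]; exact criticalProb_zd_lt_one hd
  have h := real_siteToBoundary_le_of_kl hd1 R q (criticalProbI d) hq0 (lt_trans hqc hpc1) hpc0 hpc1
  have hkl := binaryKL_le_sq_div hq0 hqc.le hpc1
  have hS0 : 0 ≤ ∑ x ∈ box d R,
      (bondPercolation (zdGraph d) q).real (openConnIn (↑(box d R) : Set (Site d)) 0 x) :=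
    Finset.sum_nonneg fun x _ => measureReal_nonneg
  have hq1' : 0 < (1 - (criticalProbI d : ℝ)) := by linarith
  calc (bondPercolation (zdGraph d) (criticalProbI d)).real (siteToBoundary d R)
      ≤ 2 * (bondPercolation (zdGraph d) q).real (siteToBoundary d R) +
          16 * d * binaryKL q (criticalProbI d) *
            ∑ x ∈ box d R, (bondPercolation (zdGraph d) q).real (openConnIn (↑(box d R) : Set (Site d)) 0 x) := h
    _ ≤ 2 * (bondPercolation (zdGraph d) q).real (siteToBoundary d R) +
          16 * d * (((criticalProbI d : ℝ) - q) ^ 2 / (2 * q * (1 - criticalProbI d) ^ 2)) *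
            ∑ x ∈ box d R, (bondPercolation (zdGraph d) q).real (openConnIn (↑(box d R) : Set (Site d)) 0 x) := by
        gcongr
    _ = _ := by
        field_simp
        ring

/-- **The same with the susceptibility**: for `d ≥ 2`, `0 < q < p_c`:
`π_{p_c}(R) ≤ 2 π_q(R) + (8d / (q (1 − p_c)²)) (p_c − q)² χ(q)`. [cite: DewanMuirhead2022, Thm. 1.10 and §2] -/
theorem oneArm_criticalProb_le_entropic_chi (hd : 2 ≤ d) (R : ℕ) (q : unitInterval) (hq0 : 0 < (q : ℝ))
    (hqc : (q : ℝ) < criticalProbI d) :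
    (bondPercolation (zdGraph d) (criticalProbI d)).real (siteToBoundary d R) ≤
      2 * (bondPercolation (zdGraph d) q).real (siteToBoundary d R) +
        8 * d / ((q : ℝ) * (1 - criticalProbI d) ^ 2) * ((criticalProbI d : ℝ) - q) ^ 2 * chi d q := by
  have hpc1 : (criticalProbI d : ℝ) < 1 := by rw [coe_criticalProbI]; exact criticalProb_zd_lt_one hd
  have hdR : (0 : ℝ) < d := by exact_mod_cast (show 0 < d by omega)
  have hq1' : 0 < (1 - (criticalProbI d : ℝ)) := by linarith
  have hK : 0 ≤ 8 * d / ((q : ℝ) * (1 - criticalProbI d) ^ 2) * ((criticalProbI d : ℝ) - q) ^ 2 := by positivity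
  have hχ := sum_real_openConnIn_box_le_chi hd R q (by rw [← coe_criticalProbI]; exact hqc)
  exact (oneArm_criticalProb_le_entropic hd R q hq0 hqc).trans
    (add_le_add le_rfl (mul_le_mul_of_nonneg_left hχ hK))

end Arm

end Summit.CriticalPhenomena.PercolationContinuityZ3.Theorems.Quant
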